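import Literature.Analysis.FluidPDE.RusinSverakLerayStabilityProofs
import Literature.Analysis.FluidPDE.CKNEpsilonRegularityHolds
import Literature.Analysis.FluidPDE.RusinSverakBackwardRegularityHolds
import Literature.Analysis.FluidPDE.JiaSverak2013AprioriEstimate
import Literature.Analysis.FluidPDE.LocalLerayLimitingProcedureProofs
import HarnessLib

/-!
# Rusin–Šverák's stability of singular points (**S**) over the three remaining leaves of its cone

Analysis/FluidPDE proof file (no definitions, no named facts) for the named fact
`Literature.Analysis.FluidPDE.rusin_sverak_leray_singular_points_stable` (**S**;
`RusinSverakLeraySolutions.lean`; W. Rusin, V. Šverák, *Minimal initial data for potential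
Navier–Stokes singularities*, J. Funct. Anal. 260 (2011) 879–891 = arXiv:0911.0500, **Thm. 4.2
with Lemma 2.1**, as packaged by the printed proof of Cor. 4.2, p. 8: "Apply the theorem,
together with Lemma 4.1, Proposition 2.2 and Lemma 2.1" — Leray solutions
`(u^k, p^k) ∈ NS(v₀^k)` of data bounded and weakly convergent in `Ḣ^{1/2}`, singular at
`(T, x_k)` with `x_k → x_∞`, yield a Leray solution of the weak-limit datum singular at
`(T, x_∞)`).

Outcome of the D-0026 review of the decomposition of **S** (2026-08-15): **S** is printed (the
composite above), true over the tree's class `IsLocalLeraySolution`, and needs no further named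
fact. Of the accepted reduction **S** ⇐ **K** ∧ **L** ∧ **B**
(`rusin_sverak_leray_singular_points_stable_of_weak_stability`, `RusinSverakLerayStability.lean`)
two inputs are now theorems — **L** = Lemma 2.1 (`rusin_sverak_stability_of_singularities_holds`,
`CKNEpsilonRegularityHolds.lean`) and the backward-cylinder bridge **B**
(`isRegularPoint_of_eLpNorm_parabolicCylinder_lt_top_holds`,
`RusinSverakBackwardRegularityHolds.lean`), both resting on the discharged
Robinson–Rodrigo–Sadowski Thm. 15.3 — so **S** rests on **K** (Thm. 4.2 with Lemma 4.1 and
Prop. 2.2) alone (`rusin_sverak_leray_singular_points_stable_of_weak_stability'`). **K** in turn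
is `rusin_sverak_leray_weak_stability_of_facts` (`RusinSverakLerayStabilityProofs.lean`) over
Jia–Šverák's Cor. 1 (⇐ Lemma 2, `jia_sverak_2013_corollary_1_of_lemma_2`,
`JiaSverak2013AprioriEstimate.lean`), Lemma 8, and the limiting procedure (⇐ Cor. 1, the proved
Prop. 2.2 `rusin_sverak_2011_proposition_2_2_holds` and the identification of the limit,
`localLeray_limiting_procedure_of_facts`, `LocalLerayLimitingProcedure.lean`). Composing:

* `rusin_sverak_leray_singular_points_stable_of_three_leaves :
    jia_sverak_2013_lemma_2 → jia_sverak_2013_lemma_8 → localLeray_limit_isLocalLeraySolution → S`,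

i.e. the trust base of **S** is exactly three printed results, each vendored with its own
locator and shared with the cone of Seregin's `L³` criterion — Jia–Šverák 2013 Lemma 2
(Lemarié-Rieusset's a priori estimate = Rusin–Šverák Lemma 4.1), Jia–Šverák 2013 Lemma 8 (the
uniform initial layer), and the identification of the limit of local Leray solutions (Jia–Šverák
2013, proof of Thm. 1, p. 8; Lemarié-Rieusset 2016, p. 571) — and
`rusin_sverak_leray_singular_points_stable_holds` is this theorem applied to their three
`_holds` once they exist. Nothing is asserted here.

## Mathlib / tree search

Tree (all used): `rusin_sverak_leray_singular_points_stable_of_weak_stability`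
(`RusinSverakLerayStability.lean`), `rusin_sverak_leray_weak_stability_of_facts`
(`RusinSverakLerayStabilityProofs.lean`), `rusin_sverak_stability_of_singularities_holds`
(`CKNEpsilonRegularityHolds.lean`), `isRegularPoint_of_eLpNorm_parabolicCylinder_lt_top_holds`
(`RusinSverakBackwardRegularityHolds.lean`), `jia_sverak_2013_corollary_1_of_lemma_2`
(`JiaSverak2013AprioriEstimate.lean`), `localLeray_limiting_procedure_of_facts`
(`LocalLerayLimitingProcedure.lean`), `rusin_sverak_2011_proposition_2_2_holds`
(`LocalLerayLimitingProcedureProofs.lean`). Nearest existing assemblies: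
`rusin_sverak_leray_singular_points_stable_of_leaves` (five leaves, two of them since discharged;
`RusinSverakSingularPointsStableLeaves.lean`) and `leray_theory_inputs_of_six_leaves`
(`RusinSverakWeakStabilitySixLeaves.lean`, **S** as a conjunct over six hypotheses, three of
which **S** does not use); nothing named `*_of_three_leaves` / `*_of_weak_stability'` (`lean search`).

## References

* W. Rusin, V. Šverák, J. Funct. Anal. 260 (2011) 879–891 = arXiv:0911.0500: Prop. 2.2 and
  Lemma 2.1 (p. 4), Lemma 4.1 and Thm. 4.2 (p. 7), proof of Cor. 4.2 (p. 8). [RusinSverak2011]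
* H. Jia, V. Šverák, SIAM J. Math. Anal. 45 (2013) 1448–1459 = arXiv:1201.1592: Lemma 2, Cor. 1
  (pp. 3–4), Lemma 8 (pp. 7–8), proof of Thm. 1 (p. 8). [JiaSverak2013]
* P. G. Lemarié-Rieusset, *The Navier–Stokes Problem in the 21st Century* (2016),
  doi:10.1201/b19556, proof of Thm. 15.5, PDF pp. 570–571. [LemarieRieusset2016]
* J. C. Robinson, J. L. Rodrigo, W. Sadowski, *The three-dimensional Navier–Stokes equations*
  (2016), Thm. 15.3, Cor. 15.6. [RobinsonRodrigoSadowski2016]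
-/

noncomputable section

namespace Literature.Analysis.FluidPDE

/-- **S rests on K alone.** Rusin–Šverák's stability of singular points
(`rusin_sverak_leray_singular_points_stable`, Thm. 4.2 with Lemma 2.1) follows from the weak
stability of `NS(u₀)` (**K** `rusin_sverak_leray_weak_stability`, Thm. 4.2 with Lemma 4.1 and
Prop. 2.2): the other two inputs of the accepted reduction
`rusin_sverak_leray_singular_points_stable_of_weak_stability` — Lemma 2.1 (**L**) and the
backward-cylinder bridge (**B**) — are theorems of the tree.
[cite: RusinSverak2011, Thm. 4.2 with Lemma 2.1, proof of Cor. 4.2 (arXiv:0911.0500 pp. 4, 7–8)] -/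
theorem rusin_sverak_leray_singular_points_stable_of_weak_stability'
    (hK : rusin_sverak_leray_weak_stability) : rusin_sverak_leray_singular_points_stable :=
  rusin_sverak_leray_singular_points_stable_of_weak_stability hK
    rusin_sverak_stability_of_singularities_holds
    isRegularPoint_of_eLpNorm_parabolicCylinder_lt_top_holds

/-- **S over the three remaining leaves of its cone.** Rusin–Šverák's stability of singular
points (`rusin_sverak_leray_singular_points_stable`, Thm. 4.2 with Lemma 2.1 via Lemma 4.1 and
Prop. 2.2) follows from Jia–Šverák's Lemma 2 (the a priori estimate, = Lemma 4.1), Jia–Šverák's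
Lemma 8 (the uniform initial layer) and the identification of the limit of local Leray solutions
(the limit step of the proof of Thm. 4.2 / of Jia–Šverák's Thm. 1): **K** by
`rusin_sverak_leray_weak_stability_of_facts` over Cor. 1 (`jia_sverak_2013_corollary_1_of_lemma_2`)
and the limiting procedure (`localLeray_limiting_procedure_of_facts`, with the proved Prop. 2.2
`rusin_sverak_2011_proposition_2_2_holds`), then
`rusin_sverak_leray_singular_points_stable_of_weak_stability'`. The discharge
`rusin_sverak_leray_singular_points_stable_holds` is this theorem applied to the three `_holds`.
[cite: RusinSverak2011, Thm. 4.2 with Lemma 2.1, proof of Cor. 4.2 (arXiv:0911.0500 pp. 4, 7–8)] -/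
theorem rusin_sverak_leray_singular_points_stable_of_three_leaves
    (h₂ : jia_sverak_2013_lemma_2) (h₈ : jia_sverak_2013_lemma_8)
    (hI : localLeray_limit_isLocalLeraySolution) :
    rusin_sverak_leray_singular_points_stable :=
  rusin_sverak_leray_singular_points_stable_of_weak_stability'
    (rusin_sverak_leray_weak_stability_of_facts (jia_sverak_2013_corollary_1_of_lemma_2 h₂) h₈
      (localLeray_limiting_procedure_of_facts (jia_sverak_2013_corollary_1_of_lemma_2 h₂)
        rusin_sverak_2011_proposition_2_2_holds hI))

/-- **K over the two remaining leaves of its own cone plus Lemma 8** (for the consumers of **K**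
itself: Cor. 4.1-type statements and the corollaries of `RusinSverakLerayStability.lean`):
Rusin–Šverák's Thm. 4.2 (packaged with Lemma 4.1 and Prop. 2.2) from Jia–Šverák's Lemma 2,
Lemma 8 and the identification of the limit, Prop. 2.2 being proved.
[cite: RusinSverak2011, Thm. 4.2 with Lemma 4.1 and Prop. 2.2 (arXiv:0911.0500 pp. 4, 7)] -/
theorem rusin_sverak_leray_weak_stability_of_three_leaves
    (h₂ : jia_sverak_2013_lemma_2) (h₈ : jia_sverak_2013_lemma_8)
    (hI : localLeray_limit_isLocalLeraySolution) :
    rusin_sverak_leray_weak_stability :=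
  rusin_sverak_leray_weak_stability_of_facts (jia_sverak_2013_corollary_1_of_lemma_2 h₂) h₈
    (localLeray_limiting_procedure_of_facts (jia_sverak_2013_corollary_1_of_lemma_2 h₂)
      rusin_sverak_2011_proposition_2_2_holds hI)

end Literature.Analysis.FluidPDE

end
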